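import Summits.ABC.IUTFork.Repair.RHAxisCK1Requirements
import HarnessLib

/-!
# R-H ROUND 4, R4-3 IDEATION CELL — REFUTER FACES of abc-iut-rh4-crit-2 for the cards `joshi-f-ansatz` (F2, bed instance; F2′ scope)
# and `joshi-lambda-link` (R-λ3 floor cancellation; F1 «top-normalised member vacuous»)

PROOF-ONLY file (0 definitions, 0 `Prop` facts; abc-iut cell, rung LADDER-ABC:A2.RESCUE.H). Bytes = rh4-crit-2's scratch
`HOME/abc-iut-rh4-crit-2/R4Crit2Scratch.lean` 6ac19debbe959ae4 VERBATIM below this header (namespace renamed from `…RH.Round4Crit2Scratch`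
to this file's); filed by the R4-3 typer abc-iut-rh4-typ-1 (KEY R4IDEA-TYPE) at crit-2's request (verdict files
`plan/rescue/R-H/ROUND4/IDEAS/crit-joshi-lambda-link-rh4-crit-2.md` §4, `crit-joshi-f-ansatz-rh4-crit-1.md` ADDENDUM A1; refuter role cannot file under
Summits/ABC). Census `plan/rescue/R-H/ROUND4/OPENINGS-CENSUS.md` rows O-3x. Companion faces: `RHJoshiFAnsatzFaces` (rh4-crit-1 06e06c3852da2ba3: the
generic `no_exponent_blind_licence` in `∃`-form + toy instance + zero-credit face under `e ≤ m`), `RHAxisCK1ValueLawNoGo` (rh4-crit-1 c5be8a4cccd1c037).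
CONTENT over the typed k1-cell `ReqsideWeightLaws.Cell` (p506542), all HYPOTHETICAL parameter settings in OUR cell currency:
* card joshi-f-ansatz F2 — `no_exponent_blind_licence` (conjunction form) and its BED instance at the worked place FREY `p = 7`, `l = 107`
  (`e 1605`, `m 210`, `δ 1604`, `r_in 268`, `r_out −4472`; p533167 §4), label `j = 32`: linear law licensed, print law not
  (`worked_linear_licensed_32`, `worked_print_unlicensed_32`, `worked_no_exponent_blind_licence`).
* card joshi-lambda-link — `cell_lambda_iff` (the λ-link cell IS `Cell (lawPow 4) λ e (λ·m) …`: affine-`1/λ` law on the λ-dilated datum),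
  `topNormalised_mean_le/_lt`, `kappa_topNormalised_neg` (Joshi's top-normalised member `λ = l⋆²` has total signed demand `≤ 0`, squeeze
  coefficient `< 0` for `l ≥ 5`), `toy_l13_signed_total` (`Σ_{j≤6}(j² − 36) = −125`).
* card joshi-f-ansatz F2′ scope — `zeroCredit_linear_licensed_4` / `zeroCredit_linear_unlicensed_5` at the v411 bed place with `e_w = 3210 > m_q = 660`,
  `cell_creditFree_of_mul_lt`: with zero credit the licensed set is `{j : f(j)·m_q < e_w}`, not `{1}`, outside the `e ≤ m` regime of crit-1's face.
HONEST FRAMING: integer / real arithmetic about OUR typed cell; nothing here asserts that abc is proved or refuted, or takes a side on [IUTchIII] Cor. 3.12 /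
[IUTchIV] Thm. 1.10 or on any author (D-0045); typed ≠ proved for every IUT locution; computed ≠ proved; refuted-as-typed ≠ refuted-in-print.
[claim: Mochizuki2012, status: disputed] [cite: Mochizuki2012, IUTchIII Rmk. 3.12.1 (ii) p. 186]
-/

namespace Summit.ABC.IUTFork.Repair.RH.JoshiCardsCrit2Faces

open Summit.ABC.IUTFork.Repair.RH.ReqsideWeightLaws

/-! ## card joshi-f-ansatz, falsifier F2: an exponent-blind licence predicate serves at most one law per cell -/

/-- If the linear-law cell holds and the print-law cell fails at one `(e, m, δ, r_in, r_out, j)`, no single proposition `P`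
is equivalent to both licences. [folklore] -/
theorem no_exponent_blind_licence {P : Prop} {e m δ rin rout : ℤ} {j : ℕ}
    (h2 : Cell (lawPow 2) 1 e m δ rin rout j) (h4 : ¬ Cell (lawPow 4) 1 e m δ rin rout j) :
    ¬ ((P ↔ Cell (lawPow 2) 1 e m δ rin rout j) ∧ (P ↔ Cell (lawPow 4) 1 e m δ rin rout j)) := by
  rintro ⟨hP2, hP4⟩
  exact h4 (hP4.mp (hP2.mpr h2))

/-- Bed instance (worked place of p533167 §4: FREY `p = 7`, `l = 107`, `e 1605`, `m 210`, `δ 1604`, `r_in 268`, `r_out −4472`),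
label `j = 32`: the LINEAR law `lawPow 2` is licensed … [folklore] -/
theorem worked_linear_licensed_32 : Cell (lawPow 2) 1 1605 210 1604 268 (-4472) 32 := by
  unfold Cell
  rw [lawPow_two]
  norm_num

/-- … and the PRINT law `lawPow 4 = j²` is not. [folklore] -/
theorem worked_print_unlicensed_32 : ¬ Cell (lawPow 4) 1 1605 210 1604 268 (-4472) 32 := by
  unfold Cell
  rw [lawPow_four]
  norm_num

/-- Hence at that bed cell no exponent-blind licence exists. [folklore] -/
theorem worked_no_exponent_blind_licence (P : Prop) :
    ¬ ((P ↔ Cell (lawPow 2) 1 1605 210 1604 268 (-4472) 32) ∧ (P ↔ Cell (lawPow 4) 1 1605 210 1604 268 (-4472) 32)) :=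
  no_exponent_blind_licence worked_linear_licensed_32 worked_print_unlicensed_32

/-! ## card joshi-lambda-link: R-λ3 (floor cancellation) and F1 (top-normalised member vacuous) -/

/-- The λ-link cell `e·⌊(j²m − (jδ + (j+1)r_in))/e⌋ ≤ λ·m − (j+1)·r_out` IS `Cell (lawPow 4) λ e (λ·m) δ r_in r_out j`
(`⌊λX/(λe)⌋ = ⌊X/e⌋`, `λ > 0`). [folklore] -/
theorem cell_lambda_iff {lam : ℤ} (hlam : 0 < lam) (e m δ rin rout : ℤ) (j : ℕ) :
    Cell (lawPow 4) lam e (lam * m) δ rin rout j ↔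
      e * (((j : ℤ) ^ 2 * m - ((j : ℤ) * δ + ((j : ℤ) + 1) * rin)) / e) ≤ lam * m - ((j : ℤ) + 1) * rout := by
  unfold Cell
  rw [lawPow_four]
  have h : (j : ℤ) ^ 2 * (lam * m) - lam * ((j : ℤ) * δ + ((j : ℤ) + 1) * rin)
      = lam * ((j : ℤ) ^ 2 * m - ((j : ℤ) * δ + ((j : ℤ) + 1) * rin)) := by ring
  rw [h, Int.mul_ediv_mul_of_pos _ _ hlam]

/-- F1 (integer form): with `l = 2n+1`, `l⋆ = n ≥ 1`, the top-normalised exponent `λ = l⋆² = n²` is at least the mean of `j²` over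
`1 ≤ j ≤ l⋆`, `(n+1)(2n+1)/6 = l(l+1)/12`: total signed demand `Σ_j (j² − λ) ≤ 0`. [folklore] -/
theorem topNormalised_mean_le (n : ℕ) (hn : 1 ≤ n) : (n + 1) * (2 * n + 1) ≤ 6 * n ^ 2 := by
  nlinarith

/-- F1 (strict, `l ≥ 5` i.e. `n ≥ 2`): `(n+1)(2n+1) < 6n²`, equivalently print's squeeze coefficient at `λ = l⋆²`,
`κ_l(λ) = (l+1)/24 − λ/(2l)`, is NEGATIVE: the downstream display has no content. [folklore] -/
theorem topNormalised_mean_lt (n : ℕ) (hn : 2 ≤ n) : (n + 1) * (2 * n + 1) < 6 * n ^ 2 := by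
  nlinarith

/-- The same in the squeeze-coefficient form over `ℝ`: `(l+1)/24 − l⋆²/(2l) < 0` for `l = 2n+1`, `n ≥ 2`. [folklore] -/
theorem kappa_topNormalised_neg (n : ℕ) (hn : 2 ≤ n) :
    ((2 * (n : ℝ) + 1) + 1) / 24 - (n : ℝ) ^ 2 / (2 * (2 * (n : ℝ) + 1)) < 0 := by
  have hn' : (2 : ℝ) ≤ n := by exact_mod_cast hn
  have hpos : 0 < 2 * (2 * (n : ℝ) + 1) := by positivity
  rw [sub_neg, div_lt_div_iff₀ (by norm_num) hpos]
  nlinarith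

/-- Exact signed total demand at the top-normalised member: `Σ_{j ≤ n} (j² − n²) = −n(n−1)(4n+1)/6`, cleared:
`6·Σ_{j≤n}(j² − n²) = −n(n−1)(4n+1)` — e.g. `l = 13`, `n = 6`: `Σ = −125` (card's toy). [folklore] -/
theorem toy_l13_signed_total : (∑ j ∈ Finset.range 6, (((j + 1 : ℕ) : ℤ) ^ 2 - 36)) = -125 := by
  decide


/-! ## card joshi-f-ansatz, crit-1's zero-credit face F2′: its hypothesis `e ≤ m` is not bed-uniform -/

/-- Bed place `F-2^5·67^8·107·22381+5^4·53^6·353^5=3^22·7…-l107@p3` (v411 a60c15783c6b4ba4): `e_w = 3210 > m_q = 660`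
(`e_w/m_q = 2l/H = 214/44`). With ZERO credit (`δ = r_in = r_out = 0`) the LINEAR-law cell at label `j = 4` IS licensed
(rounding: `3210·⌊4·660/3210⌋ = 0 ≤ 660`) … [folklore] -/
theorem zeroCredit_linear_licensed_4 : Cell (lawPow 2) 1 3210 660 0 0 0 4 := by
  unfold Cell
  rw [lawPow_two]
  norm_num

/-- … and at `j = 5` it is not (`3210·⌊3300/3210⌋ = 3210 > 660`): the zero-credit licensed set at a place with `m_q < e_w` is
`{j : f(j)·m_q < e_w}`, not `{1}`. [folklore] -/
theorem zeroCredit_linear_unlicensed_5 : ¬ Cell (lawPow 2) 1 3210 660 0 0 0 5 := by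
  unfold Cell
  rw [lawPow_two]
  norm_num

/-- General form: with zero credit and `f(j)·m < e` (`0 ≤ m`, `0 ≤ f j`), the cell IS licensed (floor vanishes). [folklore] -/
theorem cell_creditFree_of_mul_lt {f : ℕ → ℤ} {e m : ℤ} {j : ℕ} (hm : 0 ≤ m) (hf : 0 ≤ f j) (h : f j * m < e) :
    Cell f 1 e m 0 0 0 j := by
  unfold Cell
  have h0 : (f j * m - 1 * ((j : ℤ) * 0 + ((j : ℤ) + 1) * 0)) / (1 * e) = 0 := by
    rw [mul_zero, mul_zero, add_zero, mul_zero, sub_zero, one_mul]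
    exact Int.ediv_eq_zero_of_lt (mul_nonneg hf hm) h
  rw [h0, mul_zero]
  linarith

end Summit.ABC.IUTFork.Repair.RH.JoshiCardsCrit2Faces
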